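import Literature.RingTheory.CompleteLocalRings.CoefficientFieldFormallyEtale
import Mathlib.RingTheory.Etale.Field
import HarnessLib

/-!
# [OURS · L0 W4.1] K-GG2 (a): a coefficient field of a complete local ring compatible with a given coefficient field downstairs,
# along a RESIDUALLY SEPARABLE local map (chain W4.1 `FrobeniusClosingSteer`, crux stmt-ResolutionOfSingularities-16345;
# res-L0-w41-tri-1 `v621/KGG-signatures.md` 036f669dd3fa960c K-GG2 (a); `--supports … --as helper`)

HONEST FRAMING. OURS kernel (HIRONAKA-L librarian res-D-lib-1 gen 7). Matsumura Thm. 28.3 (iii)+(iv) in the RELATIVE form the chain's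
residually separable point steps need: `φ : A → B` a local map of local rings, `B` complete, `s₀ : κ(A) → A` a coefficient field of `A`,
`κ(B)` SEPARABLE over `κ(A)` (through `κ(φ)`) ⟹ there is a coefficient field `s₁ : κ(B) → B` of `B` with `s₁ ∘ κ(φ) = φ ∘ s₀`.
PROOF = the tree's Thm. 28.3 (iv) for complete rings (`Literature.RingTheory.CompleteLocalRings.exists_algHom_comp_residue_eq_id`:
a `k`-algebra section of the residue map exists as soon as `κ(B)` is formally smooth over `k`) with `k := κ(A)` acting on `B` through
`φ ∘ s₀`, and Mathlib's «separable ⇒ formally étale» (`Algebra.FormallyEtale.of_isSeparable`). No Hensel lemma and no primitive element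
are needed, and NO finiteness of `κ(B)/κ(A)`. NOTHING here is a statement of H. Hironaka's manuscript [Hironaka2017]. AI-written; AI
review is weaker than expert review. Reference: H. Matsumura, *Commutative Ring Theory*, Thm. 28.3. [Matsumura1987]
-/

set_option linter.dupNamespace false

namespace Summit.ResolutionOfSingularities.ResolutionOfSingularities.Theorems.SwitchingDichotomy.TwoBasis

open IsLocalRing

/-- **K-GG2 (a)** (tri-1): along a local map `φ : A → B` into a COMPLETE local ring whose residue field is SEPARABLE over that of `A`
(for the structure `κ(φ) = ResidueField.map φ`), every coefficient field `s₀` of `A` is covered by a coefficient field `s₁` of `B`: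
`(residue B) ∘ s₁ = id` and `s₁ ∘ κ(φ) = φ ∘ s₀`. (Existence only; uniqueness of `s₁` among `κ(A)`-compatible sections also holds by
formal unramifiedness and is not recorded here.) [cite: Matsumura1987, Thm. 28.3 (iii), (iv)] -/
theorem exists_coeffField_comp_eq {A B : Type} [CommRing A] [CommRing B] [IsLocalRing A] [IsLocalRing B]
    [IsAdicComplete (maximalIdeal B) B] (φ : A →+* B) [IsLocalHom φ] (s₀ : ResidueField A →+* A)
    (hs₀ : (residue A).comp s₀ = RingHom.id _)
    (hsep : @Algebra.IsSeparable (ResidueField A) (ResidueField B) _ _ (ResidueField.map φ).toAlgebra) :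
    ∃ s₁ : ResidueField B →+* B, (residue B).comp s₁ = RingHom.id _ ∧ s₁.comp (ResidueField.map φ) = φ.comp s₀ := by
  -- `B` as a `κ(A)`-algebra through `φ ∘ s₀`; the induced structure on `κ(B)` is `κ(φ)` because `residue_A ∘ s₀ = id`
  letI algAB : Algebra (ResidueField A) B := (φ.comp s₀).toAlgebra
  have hres : ∀ c : ResidueField A, algebraMap (ResidueField A) (ResidueField B) c = ResidueField.map φ c := by
    intro c
    obtain ⟨a, rfl⟩ := residue_surjective c
    change residue B (φ (s₀ (residue A a))) = ResidueField.map φ (residue A a)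
    rw [ResidueField.map_residue]  -- `κ(φ) (residue a) = residue (φ a)`
    -- `s₀ (residue a) ≡ a (mod 𝔪_A)`
    have h : residue A (s₀ (residue A a)) = residue A a := by
      have := RingHom.congr_fun hs₀ (residue A a)
      simpa using this
    rw [← sub_eq_zero, ← map_sub, ← map_sub, residue_eq_zero_iff]
    rw [← sub_eq_zero, ← map_sub, residue_eq_zero_iff] at h
    exact map_nonunit φ _ h
  -- separability transfers to the induced algebra structure (same underlying ring map)
  haveI : Algebra.IsSeparable (ResidueField A) (ResidueField B) := by
    convert hsep using 1
    exact Algebra.algebra_ext _ _ fun c => by rw [hres c]; rfl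
  haveI : Algebra.FormallyEtale (ResidueField A) (ResidueField B) := Algebra.FormallyEtale.of_isSeparable _ _
  obtain ⟨σ, hσ⟩ := Literature.RingTheory.CompleteLocalRings.exists_algHom_comp_residue_eq_id
    (k := ResidueField A) (A := B)
  refine ⟨σ.toRingHom, RingHom.ext fun x => hσ x, RingHom.ext fun c => ?_⟩
  change σ (ResidueField.map φ c) = φ (s₀ c)
  rw [← hres c, AlgHom.commutes]
  rfl

/-- **Uniqueness companion of K-GG2 (a)**: two coefficient fields of the complete `B` that are both compatible with `s₀` along `φ`
coincide (the residue field is formally unramified over `κ(A)`; Matsumura 28.3 (iv) uniqueness, tree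
`algHom_comp_residue_eq_id_unique`). [cite: Matsumura1987, Thm. 28.3 (iv)] -/
theorem coeffField_comp_eq_unique {A B : Type} [CommRing A] [CommRing B] [IsLocalRing A] [IsLocalRing B]
    [IsAdicComplete (maximalIdeal B) B] (φ : A →+* B) [IsLocalHom φ] (s₀ : ResidueField A →+* A)
    (hs₀ : (residue A).comp s₀ = RingHom.id _)
    (hsep : @Algebra.IsSeparable (ResidueField A) (ResidueField B) _ _ (ResidueField.map φ).toAlgebra)
    (s₁ s₂ : ResidueField B →+* B) (h₁ : (residue B).comp s₁ = RingHom.id _) (h₁' : s₁.comp (ResidueField.map φ) = φ.comp s₀)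
    (h₂ : (residue B).comp s₂ = RingHom.id _) (h₂' : s₂.comp (ResidueField.map φ) = φ.comp s₀) : s₁ = s₂ := by
  letI algAB : Algebra (ResidueField A) B := (φ.comp s₀).toAlgebra
  have hres : ∀ c : ResidueField A, algebraMap (ResidueField A) (ResidueField B) c = ResidueField.map φ c := by
    intro c
    obtain ⟨a, rfl⟩ := residue_surjective c
    change residue B (φ (s₀ (residue A a))) = ResidueField.map φ (residue A a)
    rw [ResidueField.map_residue]
    have h : residue A (s₀ (residue A a)) = residue A a := by
      have := RingHom.congr_fun hs₀ (residue A a)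
      simpa using this
    rw [← sub_eq_zero, ← map_sub, ← map_sub, residue_eq_zero_iff]
    rw [← sub_eq_zero, ← map_sub, residue_eq_zero_iff] at h
    exact map_nonunit φ _ h
  haveI : Algebra.IsSeparable (ResidueField A) (ResidueField B) := by
    convert hsep using 1
    exact Algebra.algebra_ext _ _ fun c => by rw [hres c]; rfl
  haveI : Algebra.FormallyUnramified (ResidueField A) (ResidueField B) := Algebra.FormallyUnramified.of_isSeparable _ _
  -- both sections are `κ(A)`-algebra maps for the structure `φ ∘ s₀`
  have hcomm : ∀ (s : ResidueField B →+* B), s.comp (ResidueField.map φ) = φ.comp s₀ →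
      ∀ c : ResidueField A, s (algebraMap (ResidueField A) (ResidueField B) c) = algebraMap (ResidueField A) B c :=
    fun s hs c => by rw [hres c]; exact RingHom.congr_fun hs c
  let σ₁ : ResidueField B →ₐ[ResidueField A] B := { s₁ with commutes' := hcomm s₁ h₁' }
  let σ₂ : ResidueField B →ₐ[ResidueField A] B := { s₂ with commutes' := hcomm s₂ h₂' }
  have h := Literature.RingTheory.CompleteLocalRings.algHom_comp_residue_eq_id_unique (ResidueField A) B σ₁ σ₂
    (fun x => RingHom.congr_fun h₁ x) (fun x => RingHom.congr_fun h₂ x)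
  exact RingHom.ext fun x => by simpa [σ₁, σ₂] using AlgHom.congr_fun h x

end Summit.ResolutionOfSingularities.ResolutionOfSingularities.Theorems.SwitchingDichotomy.TwoBasis
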